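import Summits.PneNP.PneNP.Theorems.SymmetryBudgetNoHiddenOrderLexMinSocketDefs

/-!
# `NoHiddenOrder` (stmt-PneNP-14781): the window has `⌊log₂ m⌋` indices

Route `PneNP/SymmetryBudget`; (R2c) bookkeeping. Every size bound of the function-level pipeline is `2^{O(|V|)}` in the vertex type `V` of the
window (`…PerPathCGCount`, `…PerPathCGAdm`), to be instantiated with `V := ↥(windowSet m)`; this file supplies the cardinality of the window:
`card_windowSet : (windowSet m).card = ⌊log₂ m⌋` (and `Fintype.card ↥(windowSet m) = ⌊log₂ m⌋`), with the description
`mem_windowSet_iff_le : i ∈ windowSet m ↔ m - ⌊log₂ m⌋ ≤ i` (the LAST `⌊log₂ m⌋` indices) and `two_pow_card_windowSet_le : 2 ^ |windowSet m| ≤ m`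
(for `m ≥ 1`), the form in which `2^{c·|V|} ≤ m^c` enters polynomial size bounds.
-/

set_option linter.dupNamespace false -- `Summit.PneNP.PneNP.…` (D-0017 single-conjunct layout)

namespace Summit.PneNP.PneNP.Theorems

open Finset

/-- The window consists of the last `⌊log₂ m⌋` indices. [folklore] -/
theorem mem_windowSet_iff_le {m : ℕ} (i : Fin m) : i ∈ windowSet m ↔ m - Nat.log 2 m ≤ (i : ℕ) := by
  rw [mem_windowSet_iff]
  omega

/-- **The window has `⌊log₂ m⌋` indices.** [folklore] -/
theorem card_windowSet (m : ℕ) : (windowSet m).card = Nat.log 2 m := by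
  have hk : Nat.log 2 m ≤ m := Nat.log_le_self 2 m
  have hW : windowSet m = univ \ univ.filter fun i : Fin m => (i : ℕ) < m - Nat.log 2 m := by
    ext i
    simp only [mem_windowSet_iff_le, mem_sdiff, mem_univ, mem_filter, true_and, not_lt]
  -- the initial segment `{i < m - ⌊log₂ m⌋}` of `Fin m` (cf. `Literature.Computability.Cryptography.card_filter_val_lt`)
  have hseg : (univ.filter fun i : Fin m => (i : ℕ) < m - Nat.log 2 m).card = m - Nat.log 2 m := by
    have : (univ.filter fun i : Fin m => (i : ℕ) < m - Nat.log 2 m) = (univ : Finset (Fin (m - Nat.log 2 m))).map (Fin.castLEEmb (Nat.sub_le _ _)) := by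
      ext i
      simp only [mem_filter, mem_univ, true_and, mem_map, Fin.castLEEmb_apply]
      constructor
      · intro hi; exact ⟨⟨i, hi⟩, Fin.ext rfl⟩
      · rintro ⟨j, rfl⟩; exact j.2
    rw [this, card_map, card_univ, Fintype.card_fin]
  rw [hW, card_sdiff_of_subset (filter_subset _ _), card_univ, Fintype.card_fin, hseg]
  omega

/-- The window type has `⌊log₂ m⌋` elements. [folklore] -/
theorem fintype_card_windowSet (m : ℕ) : Fintype.card ↥(windowSet m) = Nat.log 2 m := by
  rw [Fintype.card_coe, card_windowSet]

/-- `2 ^ |window| ≤ m` for `m ≥ 1`: exponential-in-the-window is linear in `m`. [folklore] -/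
theorem two_pow_card_windowSet_le {m : ℕ} (hm : 0 < m) : 2 ^ (windowSet m).card ≤ m := by
  rw [card_windowSet]
  exact Nat.pow_log_le_self 2 hm.ne'

/-- `2 ^ (c · |window|) ≤ m ^ c`: the form used in polynomial size bounds. [folklore] -/
theorem two_pow_mul_card_windowSet_le {m : ℕ} (hm : 0 < m) (c : ℕ) : 2 ^ (c * (windowSet m).card) ≤ m ^ c := by
  rw [Nat.mul_comm, pow_mul]
  exact Nat.pow_le_pow_left (two_pow_card_windowSet_le hm) c

end Summit.PneNP.PneNP.Theorems
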